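/-
Copyright (c) 2026 the pub-hodgecm-mathlib formalisation cell (harness21).  Prover seat hodgecm-mathlib-K2Liu-p13 (g3), Track B «K2-LIT»,
#184♮ = hLiu418 = `stmt-HodgeConjecture-24832`; ROAD Φ (RULING «M-156n»), consumer sheet fa2b1e3a29709f09 row G6-fin — the last by-value letter `hχ′` of the
big-cell package DISCHARGED: `χ′ := reflectChar c χ` (★ `K2E1CharacterEisensteinU2Defs.reflectChar`, the K2E1 family's reflected character `(χ ∘ (c ⊗ 1))⁻¹`).
THEOREMS ONLY (no `def`, no `instance`, no named-fact hypothesis, no `sorry`).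
-/
import Summits.HodgeConjecture.HodgeConjecture.Theorems.K2LiuBigCellGrowthOfStandard          -- ★∕📤 growth face (standard family)
import Summits.HodgeConjecture.HodgeConjecture.Theorems.K2E1CharacterEisensteinU2Defs         -- ★ `reflectChar`, `reflectChar_apply`, `IsUnitary.reflectChar`
import HarnessLib

/-!
# Crux `HLiu418`, ROAD Φ, organ Φ8 (sheet row G6-fin): THE BIG-CELL PACKAGE WITH `χ′ = χʷ := (χ ∘ (c ⊗ 1))⁻¹` BY NAME — no character letter left

Cell `hodgecm-mathlib`, crux item hLiu418 = `stmt-HodgeConjecture-24832` (helper lane, count-neutral).  GENERIC `n`, doubled frame `H(𝔸) = HA L e dV hdV dW hdW`.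
★ `K2LiuIntertwiningDeltaUnconditional` ∕ ★ `K2LiuBigCellGrowthAssembled` ∕ ★∕📤 `K2LiuBigCellGrowthOfStandard` state the intertwining law and the growth face
for ANY Hecke character `χ′` with `hχ′ : ∀ u, χ′ u = (χ ((c ⊗ 1) u))⁻¹`.  Such a `χ′` EXISTS as a Hecke character (continuity of `c ⊗ 1`, principal ideles
preserved): it is the K2E1 family's ★ `reflectChar c χ` (`reflectChar_apply`, definitional).  This file specialises the three heads to `χ′ := reflectChar c χ`:
* `reflectChar_hχ'` — `hχ′` for `reflectChar (IsCMField.complexConj L) χ` (by `rfl`);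
* **`isSiegelDeltaSection_intertwiningDelta_reflect`** — `M(s) : I(s, χ) → I(−s, χʷ)` with NO hypothesis beyond the frame (`dV, dW ≠ 0`) and `f ∈ I(s, χ)`;
* `intertwiningDelta_family_equivariant_reflect` — the family form (`heqv`);
* **`bigCell_growth_reflect_of_isStandardSectionFamily`** — the big cell's `hgrowth` summand for a standard family and unitary `χ` from the continuation `hEd` ALONE.
Sources: [MoeglinWaldspurger1995, II.1.6–II.1.7]; [GelbartRogawski1991, §3.1]; [Garrett2018, §3.10–§3.12]; [HarrisKudlaSweet1996, §6]; [KudlaSweet1997, §1].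
HONEST LABEL.  Helper lemmas, count-neutral; `HC_CM` is proved only modulo the 7 printed citations (2 remaining named inputs:
hLiu418 = `stmt-HodgeConjecture-24832`, h413 = `stmt-HodgeConjecture-24833`) until rung 0 closes.
-/

set_option autoImplicit false
set_option linter.dupNamespace false -- the mandated namespace repeats `HodgeConjecture.HodgeConjecture`

noncomputable section

open scoped Matrix NNReal ENNReal
open NumberField IsDedekindDomain MeasureTheory MeasureTheory.Measure Metric

namespace Summit.HodgeConjecture.HodgeConjecture.Cruxes.HLiu418.K2LiuIntertwiningDeltaReflect

open Literature.NumberTheory.GelbartRogawski1991.AdaptedBlocks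
open Literature.NumberTheory.Automorphic Literature.NumberTheory.Automorphic.UnitaryGroup
open Literature.NumberTheory.GelbartRogawski1991 Literature.NumberTheory.GelbartRogawski1991.GRConstruction
open Literature.NumberTheory.K2Lit.SiegelDoubled Literature.NumberTheory.GaloisRepresentations
open UnitaryDualPair
open Summit.HodgeConjecture.HodgeConjecture.Cruxes.HLiu418.K2LiuIntertwiningDeltaUnconditional
open Summit.HodgeConjecture.HodgeConjecture.Cruxes.HLiu418.K2LiuBigCellGrowthOfStandard
open Summit.HodgeConjecture.HodgeConjecture.Cruxes.H413.K2E1CharacterEisensteinU2Defs (reflectChar reflectChar_apply IsUnitary.reflectChar)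

variable (L : Type) [Field L] [NumberField L] [IsCMField L]
variable {N M n : ℕ} (e : Fin N × Fin M ≃ Fin n)
  (dV : Fin N → L) (hdV : ∀ i, IsCMField.complexConj L (dV i) = dV i)
  (dW : Fin M → L) (hdW : ∀ i, IsCMField.complexConj L (dW i) = dW i)

/-! ## §1 The letter `hχ′` for the reflected character -/

/-- `hχ′` holds for `χ′ := reflectChar c χ` (`c` = complex conjugation of the CM field `L`): `χʷ u = (χ ((c ⊗ 1) u))⁻¹`. [cite: MoeglinWaldspurger1995, II.1.7] -/
theorem reflectChar_hχ' (χ : HeckeCharacter L) :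
    ∀ u : (AdeleRing (𝓞 L) L)ˣ, reflectChar (IsCMField.complexConj L : L ≃ₐ[Fp L] L) χ u =
      (χ (Units.map (conjAdele (Fp L) L (IsCMField.complexConj L) : AdeleRing (𝓞 L) L →* AdeleRing (𝓞 L) L) u))⁻¹ :=
  fun u => reflectChar_apply χ u

/-! ## §2 The intertwining law `M(s) : I(s, χ) → I(−s, χʷ)` -/

/-- **`M(s) : I(s, χ) → I(−s, χʷ)`** for every Haar measure `νN` on `N_Δ(𝔸)`, every `s` and every `f ∈ I(s, χ)` — no further hypothesis.
[cite: MoeglinWaldspurger1995, II.1.6–II.1.7] [cite: Garrett2018, §3.10] [cite: KudlaSweet1997, §1] -/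
theorem isSiegelDeltaSection_intertwiningDelta_reflect (hdV0 : ∀ i, dV i ≠ 0) (hdW0 : ∀ i, dW i ≠ 0)
    [MeasurableSpace (unipDelta L e dV hdV dW hdW)] [BorelSpace (unipDelta L e dV hdV dW hdW)]
    (νN : Measure (unipDelta L e dV hdV dW hdW)) [νN.IsHaarMeasure] (χ : HeckeCharacter L) (s : ℂ)
    {f : HA L e dV hdV dW hdW → ℂ} (hf : IsSiegelDeltaSection L e dV hdV dW hdW χ s f) :
    IsSiegelDeltaSection L e dV hdV dW hdW (reflectChar (IsCMField.complexConj L : L ≃ₐ[Fp L] L) χ) (-s)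
      (intertwiningDelta L e dV hdV dW hdW νN f) :=
  isSiegelDeltaSection_intertwiningDelta_of_conj L e dV hdV dW hdW hdV0 hdW0 νN χ _ (reflectChar_hχ' L χ) s hf

/-- pointwise: `M(s)f (p h) = (χʷ, −s)-character(p) · M(s)f (h)` for `p ∈ P_Δ(𝔸)`. [cite: MoeglinWaldspurger1995, II.1.7] -/
theorem intertwiningDelta_siegel_mul_reflect (hdV0 : ∀ i, dV i ≠ 0) (hdW0 : ∀ i, dW i ≠ 0)
    [MeasurableSpace (unipDelta L e dV hdV dW hdW)] [BorelSpace (unipDelta L e dV hdV dW hdW)]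
    (νN : Measure (unipDelta L e dV hdV dW hdW)) [νN.IsHaarMeasure] (χ : HeckeCharacter L) (s : ℂ)
    {f : HA L e dV hdV dW hdW → ℂ} (hf : IsSiegelDeltaSection L e dV hdV dW hdW χ s f)
    {p : HA L e dV hdV dW hdW} (hp : IsSiegelDelta L e dV hdV dW hdW p) (h : HA L e dV hdV dW hdW) :
    intertwiningDelta L e dV hdV dW hdW νN f (p * h) =
      siegelDeltaCharacter L e dV hdV dW hdW (reflectChar (IsCMField.complexConj L : L ≃ₐ[Fp L] L) χ) (-s) p *
        intertwiningDelta L e dV hdV dW hdW νN f h :=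
  isSiegelDeltaSection_intertwiningDelta_reflect L e dV hdV dW hdW hdV0 hdW0 νN χ s hf p hp h

/-- the section-family packaging: `s ↦ M(−s) f_{−s}` is a `χʷ`-section family when `s ↦ f_s` is a `χ`-section family. [cite: KudlaSweet1997, §1] -/
theorem isSiegelDeltaSectionFamily_intertwiningDelta_reflect (hdV0 : ∀ i, dV i ≠ 0) (hdW0 : ∀ i, dW i ≠ 0)
    [MeasurableSpace (unipDelta L e dV hdV dW hdW)] [BorelSpace (unipDelta L e dV hdV dW hdW)]
    (νN : Measure (unipDelta L e dV hdV dW hdW)) [νN.IsHaarMeasure] (χ : HeckeCharacter L)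
    {f : ℂ → HA L e dV hdV dW hdW → ℂ} (hf : IsSiegelDeltaSectionFamily L e dV hdV dW hdW χ f) :
    IsSiegelDeltaSectionFamily L e dV hdV dW hdW (reflectChar (IsCMField.complexConj L : L ≃ₐ[Fp L] L) χ)
      (fun s => intertwiningDelta L e dV hdV dW hdW νN (f (-s))) :=
  isSiegelDeltaSectionFamily_intertwiningDelta_of_conj L e dV hdV dW hdW hdV0 hdW0 νN χ _ (reflectChar_hχ' L χ) hf

/-- the family form = the binder `heqv` of ★ `growth_of_equivariance`, with `ω s p = χʷ_det(p) · modDelta(p)^{n − 2s}`. [cite: Garrett2018, §3.10] -/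
theorem intertwiningDelta_family_equivariant_reflect (hdV0 : ∀ i, dV i ≠ 0) (hdW0 : ∀ i, dW i ≠ 0)
    [MeasurableSpace (unipDelta L e dV hdV dW hdW)] [BorelSpace (unipDelta L e dV hdV dW hdW)]
    (νN : Measure (unipDelta L e dV hdV dW hdW)) [νN.IsHaarMeasure] (χ : HeckeCharacter L)
    (c : ℝ) (f : ℂ → HA L e dV hdV dW hdW → ℂ) (hf : ∀ s : ℂ, IsSiegelDeltaSection L e dV hdV dW hdW χ s (f s)) (a : ℂ → ℂ) :
    ∀ s : ℂ, c < s.re → ∀ p ∈ {p : HA L e dV hdV dW hdW | IsSiegelDelta L e dV hdV dW hdW p}, ∀ h : HA L e dV hdV dW hdW,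
      a s * intertwiningDelta L e dV hdV dW hdW νN (f s) (p * h) =
        (((chiDet L e dV hdV dW hdW (reflectChar (IsCMField.complexConj L : L ≃ₐ[Fp L] L) χ) p : ℂˣ) : ℂ) *
            ((modDelta L e dV hdV dW hdW p : ℝ) : ℂ) ^ (((n : ℝ) : ℂ) - 2 * s)) *
          (a s * intertwiningDelta L e dV hdV dW hdW νN (f s) h) :=
  intertwiningDelta_family_equivariant_of_conj L e dV hdV dW hdW hdV0 hdW0 νN χ _ (reflectChar_hχ' L χ) c f hf a

/-! ## §3 The growth face of the big cell, no character letter -/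

/-- **THE BIG CELL's `hgrowth` SUMMAND FOR A STANDARD FAMILY, unitary `χ`, from the continuation `hEd` ALONE** (`χ′ := χʷ` by name).
[cite: Garrett2018, §3.12] [cite: MoeglinWaldspurger1995, IV.1] [cite: HarrisKudlaSweet1996, §6] [cite: KudlaSweet1997, §1] -/
theorem bigCell_growth_reflect_of_isStandardSectionFamily [NeZero n] (hdV0 : ∀ i, dV i ≠ 0) (hdW0 : ∀ i, dW i ≠ 0)
    (𝒦 : IwasawaDatum L e dV hdV dW hdW)
    [MeasurableSpace (unipDelta L e dV hdV dW hdW)] [BorelSpace (unipDelta L e dV hdV dW hdW)]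
    (νN : Measure (unipDelta L e dV hdV dW hdW)) [νN.IsHaarMeasure] (χ : HeckeCharacter L) (hχ : χ.IsUnitary)
    (f : ℂ → HA L e dV hdV dW hdW → ℂ) (hstd : IsStandardSectionFamily 𝒦 χ f) (hcont : ∀ s, Continuous (f s)) (a : ℂ → ℂ)
    (hEd : ∀ x : HA L e dV hdV dW hdW,
      DifferentiableOn ℂ (fun s : ℂ => a s * intertwiningDelta L e dV hdV dW hdW νN (f s) x) {s : ℂ | 0 < s.re}) :
    ∀ z : ℂ, 0 < z.re → ∃ C A r : ℝ, 0 < r ∧ ∀ s : ℂ, dist s z < r → ∀ x : HA L e dV hdV dW hdW,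
      ‖a s * intertwiningDelta L e dV hdV dW hdW νN (f s) x‖ ≤ C * adelicHeightGL (n + n) L (x : GL (Fin (n + n)) (AdeleRing (𝓞 L) L)) ^ A :=
  bigCell_growth_of_isStandardSectionFamily L e dV hdV dW hdW hdV0 hdW0 𝒦 νN χ _ hχ (reflectChar_hχ' L χ) f hstd hcont a hEd

/-- the reflected character of the socket's unitary `χ` is unitary (so the `I(−s, χʷ)`-side organs that ask `χ′.IsUnitary` apply). [cite: MoeglinWaldspurger1995, II.1.7] -/
theorem isUnitary_reflectChar {χ : HeckeCharacter L} (hχ : χ.IsUnitary) :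
    (reflectChar (IsCMField.complexConj L : L ≃ₐ[Fp L] L) χ).IsUnitary :=
  IsUnitary.reflectChar hχ

end Summit.HodgeConjecture.HodgeConjecture.Cruxes.HLiu418.K2LiuIntertwiningDeltaReflect

end
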